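import Literature.NumberTheory.EllipticCurves.X1ElevenFiveIsogeny
import Literature.NumberTheory.EllipticCurves.FunctionFieldLPoints
import HarnessLib

/-!
# The `5`-descent on `X₁(11)`, V-a: the divisor of Mazur's Kummer function `f_T = xy + x² + y`
# on `11A3`

For the explicit Eisenstein `5`-descent on `X₁(11)` (B. Mazur, *Modular curves and the Eisenstein
ideal*, Publ. Math. IHÉS 47 (1977), Ch. III §3; overview in `X1ElevenKummerValues`) the Kummer
map of the dual isogeny `φ̂ : 11A1 → 11A3` is `P ↦ f_T(P) mod (ℚˣ)⁵` for a function
`f_T ∈ ℚ(11A3)` with divisor `5(T) - 5(O)`, `T = (0, 0)` the rational point of order `5`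
(Silverman, *AEC*, Exercise 10.1). On `11A3 : y² + y = x³ - x²` one may take
**`f_T = xy + x² + y`**; this file proves, with the tree's point-indexed order function
`Literature.NumberTheory.EllipticCurves.WeierstrassFunctionField.ord` on `ℚ̄(11A3)`:

* `ord_zero_kummerFn` — `ord_O f_T = -5` (`f_T = x² · 1 + (x + 1) · y`, norm degree
  `max (4, 2 + 3) = 5`);
* `eq_zero_of_kummer_eq_zero` — the only affine zero of `f_T` on the curve is `T`
  (`f_T · f_{-T} = -x⁵` with `f_{-T} = x² - xy - x - y - 1`, and `f_T(0, y) = y`);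
* `ord_Tbar_kummerFn` — hence `ord_T f_T = 5` (the degree of a principal divisor is `0`);
* `ord_kummerFn` — `ord_Q f_T = 5([Q = T] - [Q = O])`, the shape consumed by the tree's
  `WeierstrassCurve.exists_stableCoset_of_kummer_eq_pow` (`IsogenyDescentWeilFunction`);
* `hasValueAt_kummerFn` — `f_T(x, y) = xy + x² + y` at affine points.

## References

* [Mazur1977] B. Mazur, *Modular curves and the Eisenstein ideal*, Publ. Math. IHÉS 47 (1977),
  Ch. III §3.
* [SilvermanAEC2009] J. H. Silverman, *The Arithmetic of Elliptic Curves*, 2nd ed. (2009),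
  Exercise 10.1 (PDF p. 304), Prop. II.3.1, III.§8.

## Design

Theorems and three small definitions with bodies (`kummerPoly`, `kummerFn`, `kummerCR`).
-/

noncomputable section

-- The `ℚ`-algebra diamond on `AlgebraicClosure ℚ` (`DivisionRing.toRatAlgebra` vs
-- `AlgebraicClosure.instAlgebra`, defeq but not at instance transparency): `geomPoints`,
-- `geomFunctionField` and the tree's `ord` are keyed on the latter, so `11A3 ⊗ ℚ̄` must be read
-- with it too (same device as in `GeomPointReduction` / `CyclotomicZpExtension`).
attribute [-instance] DivisionRing.toRatAlgebra

open scoped Classical WithZero Polynomial.Bivariate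
open Polynomial WeierstrassCurve
open Literature.NumberTheory.EllipticCurves.WeierstrassFunctionField WeierstrassCurve.geomPoints

namespace Literature.NumberTheory.EllipticCurves.X1Eleven

open Literature.NumberTheory.EllipticCurves

local notation "Qbar" => AlgebraicClosure ℚ
local notation "V11" => WeierstrassCurve.toAffine (WeierstrassCurve.baseChange curve11A3 (AlgebraicClosure ℚ))

/-- `f_T` as a two-variable polynomial: `X₀ X₁ + X₀² + X₁`.
[cite: SilvermanAEC2009, Exercise 10.1(c) (PDF p. 304)] -/
def kummerPoly : MvPolynomial (Fin 2) Qbar :=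
  MvPolynomial.X 0 * MvPolynomial.X 1 + MvPolynomial.X 0 ^ 2 + MvPolynomial.X 1

/-- **Mazur's Kummer function `f_T = xy + x² + y ∈ ℚ̄(11A3)`** (evaluation of `kummerPoly` at the
generic point). [cite: Mazur1977, Ch. III §3; SilvermanAEC2009, Exercise 10.1(c) (PDF p. 304)] -/
def kummerFn : curve11A3.geomFunctionField := curve11A3.evalGeneric kummerPoly

/-- `f_T` in the coordinate ring `ℚ̄[11A3]`, written in the basis `1, y` over `ℚ̄[x]`:
`x² · 1 + (x + 1) · y`. [folklore] -/
def kummerCR : Affine.CoordinateRing V11 :=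
  (X ^ 2 : Qbar[X]) • (1 : Affine.CoordinateRing V11) +
    (X + C 1 : Qbar[X]) • Affine.CoordinateRing.mk V11 Y

/-- `f_T = xy + x² + y` reduces to `x² · 1 + (x + 1) · y` in `ℚ̄[11A3]`. [folklore] -/
theorem mk_kummer_eq :
    Affine.CoordinateRing.mk V11 (C X * Y + C X ^ 2 + Y) = kummerCR := by
  have e : ∀ p : Qbar[X], algebraMap Qbar[X] (Affine.CoordinateRing V11) p =
      Affine.CoordinateRing.mk V11 (C p) := fun p => rfl
  rw [kummerCR, Algebra.smul_def, Algebra.smul_def, mul_one, e, e, ← map_mul, ← map_add]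
  congr 1
  simp only [map_pow, map_add, map_one]
  ring

/-- `f_T` is `kummerCR` viewed in the function field. [folklore] -/
theorem kummerFn_eq_algebraMap :
    kummerFn = algebraMap (Affine.CoordinateRing V11) curve11A3.geomFunctionField kummerCR := by
  rw [kummerFn, evalGeneric_apply, ← mk_kummer_eq]
  congr 2
  simp only [kummerPoly, map_add, map_mul, map_pow,
    Polynomial.Bivariate.equivMvPolynomial_symm_X_0,
    Polynomial.Bivariate.equivMvPolynomial_symm_X_1]

/-- `kummerCR ≠ 0` (its `1`-component `x²` is non-zero). [folklore] -/
theorem kummerCR_ne_zero : kummerCR ≠ 0 := fun h0 =>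
  pow_ne_zero 2 X_ne_zero (Affine.CoordinateRing.smul_basis_eq_zero h0).1

/-- `f_T ≠ 0`. [folklore] -/
theorem kummerFn_ne_zero : kummerFn ≠ 0 := by
  rw [kummerFn_eq_algebraMap]
  exact (map_ne_zero_iff _ (FaithfulSMul.algebraMap_injective (Affine.CoordinateRing V11)
    curve11A3.geomFunctionField)).mpr kummerCR_ne_zero

/-- `f_T(a, b) = ab + a² + b` as the value of the regular function `kummerCR`. [folklore] -/
theorem pointEval_kummerCR {a b : Qbar} (h : (V11).Equation a b) :
    pointEval h kummerCR = a * b + a ^ 2 + b := by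
  rw [← mk_kummer_eq, pointEval_mk]
  simp only [evalEval_add, evalEval_mul, evalEval_pow, evalEval_C, evalEval_X, eval_X]

/-! ### The pole at `O` -/

/-- **`ord_O f_T = -5`**: the norm of `x² + (x + 1) y` has degree `max (2·2, 2·1 + 3) = 5`.
[cite: SilvermanAEC2009, Exercise 10.1(c) (PDF p. 304)] -/
theorem ord_zero_kummerFn : ord V11 0 kummerFn = -5 := by
  have hX2 : (X ^ 2 : Qbar[X]) ≠ 0 := pow_ne_zero 2 X_ne_zero
  have hX1 : (X + C 1 : Qbar[X]) ≠ 0 := X_add_C_ne_zero 1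
  rw [kummerFn_eq_algebraMap, ord_zero_algebraMap kummerCR_ne_zero, kummerCR,
    normDeg_smul_basis_eq _ _ (Or.inl hX2), if_neg hX1, if_neg hX2, natDegree_pow, natDegree_X,
    natDegree_X_add_C]
  norm_num

/-! ### The zeros: only `T` -/

/-- **The only zero of `f_T` on `11A3` is `T = (0, 0)`**: `f_T · f_{-T} = -x⁵` on the curve
(`f_{-T} = x² - xy - x - y - 1`), so `f_T(a, b) = 0` forces `a = 0` and then `b = f_T(0, b) = 0`.
[cite: SilvermanAEC2009, Exercise 10.1(c) (PDF p. 304)] -/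
theorem eq_zero_of_kummer_eq_zero {a b : Qbar} (he : b ^ 2 + b = a ^ 3 - a ^ 2)
    (hf : a * b + a ^ 2 + b = 0) : a = 0 ∧ b = 0 := by
  have hprod : (a * b + a ^ 2 + b) * (a ^ 2 - a * b - a - b - 1) = -a ^ 5 := by
    linear_combination (-(a + 1) ^ 2) * he
  rw [hf, zero_mul] at hprod
  have ha : a = 0 := pow_eq_zero_iff (n := 5) (by norm_num) |>.mp (neg_eq_zero.mp hprod.symm)
  refine ⟨ha, ?_⟩
  rw [ha] at hf
  simpa using hf

/-- `ord_Q f_T ≥ 0` at affine `Q`. [folklore] -/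
theorem ord_some_kummerFn_nonneg {a b : Qbar} (h : (V11).Nonsingular a b) :
    0 ≤ ord V11 (.some a b h) kummerFn := by
  rw [kummerFn_eq_algebraMap]; exact ord_some_algebraMap_nonneg h _

/-- `ord_Q f_T > 0` at affine `Q = (a, b)` iff `ab + a² + b = 0`. [folklore] -/
theorem ord_some_kummerFn_pos_iff {a b : Qbar} (h : (V11).Nonsingular a b) :
    0 < ord V11 (.some a b h) kummerFn ↔ a * b + a ^ 2 + b = 0 := by
  rw [kummerFn_eq_algebraMap, ord_some_algebraMap_pos_iff h kummerCR_ne_zero, pointEval_kummerCR]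

/-- `(0, 0)` is a nonsingular point of `11A3/ℚ̄`. [folklore] -/
theorem nonsingular_zero_zero : (V11).Nonsingular 0 0 :=
  (nonsingular_geom_curve11A3_iff 0 0).mpr (by norm_num)

/-- `T̄` is the affine point `(0, 0)`. [folklore] -/
theorem Tbar_eq : Tbar = Affine.Point.some 0 0 nonsingular_zero_zero := rfl

/-- A point with `ord_Q f_T ≠ 0`, `Q ≠ O`, is `T̄`. [folklore] -/
theorem eq_Tbar_of_ord_ne_zero {Q : (V11).Point} (hQ : Q ≠ 0) (hF : ord V11 Q kummerFn ≠ 0) :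
    Q = Affine.Point.some 0 0 nonsingular_zero_zero := by
  rcases Q with _ | ⟨a, b, h⟩
  · exact (hQ rfl).elim
  · have hpos : 0 < ord V11 (.some a b h) kummerFn :=
      lt_of_le_of_ne (ord_some_kummerFn_nonneg h) (Ne.symm hF)
    rw [ord_some_kummerFn_pos_iff h] at hpos
    obtain ⟨rfl, rfl⟩ := eq_zero_of_kummer_eq_zero ((nonsingular_geom_curve11A3_iff a b).mp h) hpos
    rfl

/-- **`ord_T f_T = 5`** (the degree of the principal divisor `div f_T` is `0`, its only pole is
`O` of order `5` and its only zero is `T`). [cite: SilvermanAEC2009, Exercise 10.1(c) (PDF p. 304) with Prop. II.3.1(b)] -/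
theorem ord_Tbar_kummerFn :
    ord V11 (Affine.Point.some 0 0 nonsingular_zero_zero) kummerFn = 5 := by
  set F : (V11).Point → ℤ := fun Q => ord V11 Q kummerFn with hF
  set Z : Finset (V11).Point := {Affine.Point.some 0 0 nonsingular_zero_zero} with hZ
  have hZ0 : (0 : (V11).Point) ∉ Z := by
    rw [hZ, Finset.mem_singleton]
    exact (Affine.Point.some_ne_zero _).symm
  have hzeros : ∀ Q : (V11).Point, Q ≠ 0 → F Q ≠ 0 → Q ∈ Z := fun Q hQ hFQ => by
    rw [hZ, Finset.mem_singleton]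
    exact eq_Tbar_of_ord_ne_zero hQ hFQ
  obtain ⟨hcount, -⟩ := finsum_mul_eq_of_zeros F 5 (finite_support_ord kummerFn_ne_zero)
    (finsum_ord kummerFn_ne_zero) ord_zero_kummerFn Z hZ0 hzeros
  rw [hZ, Finset.sum_singleton] at hcount
  exact_mod_cast hcount

/-- **`div f_T = 5(T) - 5(O)`**: `ord_Q f_T = 5([Q = T̄] - [Q = O])` for every geometric point
`Q` of `11A3` — the divisor hypothesis of the tree's
`WeierstrassCurve.exists_stableCoset_of_kummer_eq_pow`.
[cite: SilvermanAEC2009, Exercise 10.1(c) (PDF p. 304); Mazur1977, Ch. III §3] -/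
theorem ord_kummerFn (Q : geomPoints curve11A3) :
    ord (curve11A3.baseChange (AlgebraicClosure ℚ)).toAffine Q kummerFn =
      ((5 : ℕ) : ℤ) * ((if Q = Tbar then 1 else 0) - (if Q = 0 then 1 else 0)) := by
  by_cases hQ0 : Q = 0
  · subst hQ0
    rw [if_neg (fun h => Tbar_ne_zero h.symm), if_pos rfl]
    exact ord_zero_kummerFn.trans (by norm_num)
  by_cases hQT : Q = Tbar
  · subst hQT
    rw [if_pos rfl, if_neg Tbar_ne_zero]
    exact ord_Tbar_kummerFn.trans (by norm_num)
  · rw [if_neg hQT, if_neg hQ0, sub_zero, mul_zero]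
    by_contra hF
    exact hQT ((eq_Tbar_of_ord_ne_zero hQ0 hF).trans Tbar_eq.symm)

/-! ### Values at affine points -/

/-- **`f_T(x, y) = xy + x² + y`** at an affine geometric point. [folklore] -/
theorem hasValueAt_kummerFn {x y : Qbar} (h : (V11).Nonsingular x y) :
    curve11A3.HasValueAt kummerFn (Affine.Point.some x y h) (x * y + x ^ 2 + y) := by
  have := hasValueAt_evalGeneric (W := curve11A3) kummerPoly (Affine.Point.some x y h)
  rw [xy_some] at this
  simpa [kummerPoly, kummerFn] using this

end Literature.NumberTheory.EllipticCurves.X1Eleven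

end
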